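import Literature.Barriers.ValiantsHypothesis.GCTMatrixPowering
import Literature.Computability.AlgebraicComplexity.PlethysmHookVanishing
import Literature.Computability.AlgebraicComplexity.Polarization
import Literature.Computability.AlgebraicComplexity.OrbitClosureWeights
import Literature.Computability.Complexity.PlethysmStabilityBIP
import Literature.NumberTheory.DiophantineGeometry.SymmetricGroupRepsFinrankSpechtProofs
import HarnessLib

/-!
# Gesmundo–Ikenmeyer–Panova 2017, Thm. 10 (`GIP2017_thm10`): the printed proof assembled —
# Lemma 12 and Prop. 13 PROVED, the positivity Prop. 14 / Prop. 20 as named facts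

Sibling proofs file (D-0014) of `Literature/Barriers/ValiantsHypothesis/GCTMatrixPowering.lean`
(conventions as there: tree letters PERMANENT size `n`, MATRIX size `m`, so GIP's `(m, n)` is our
`(n, m)`; `V = ℂ^{m²}` with the lexicographic matrix variables `MatIdx m`; "`λ ⊢ d·n` occurs in
`ℂ[\overline{GL_{m²} per_n}]_d`" is `HasHighestWeight (blockPerOrbitRep n m) (partitionWeightLex m λ)`,
"`λ` occurs in `ℂ[𝔸]_d = Sym^d Sym^n V`" (plethysm coefficient `a_λ(d[n]) > 0`) is
`HasHighestWeight (coordRep (MatIdx m) ℂ n) (partitionWeightLex m λ)`; `sm(λ, m) > 0` is `SmPos m λ`).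

GIP prove their Main Result, Thm. 10 ("Let `m ≥ 10` and `n ≥ m + 2`. For every `λ ⊢ dm` that
satisfies `q_λ(d[m]) > 0` we have `sm(λ, n) > 0`"), on p. 7 of the held text (arXiv:1611.00827,
flat numbering) from three results:

* **Lemma 12**: "`q_λ(d[m]) ≤ a_λ(d[m])`. Moreover, if `q_λ(d[m]) > 0`, then `ℓ(λ) ≤ m²` and
  `|λ| = md`" (the orbit closure is an affine subvariety of `𝔸_n^m`, so its coordinate ring is a
  quotient of `ℂ[𝔸_n^m]_d = ⊕ V_λ^{a_λ(d[m])}`; `ℓ(λ) ≤ m²` "just because the `per_m` has only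
  `m²` variables" [BLMW]). PROVED here (`GIP2017_lemma12`): the first part is the tree's BLMW lift
  `hasHighestWeight_coordRep_of_orbitCoordRep` (discharged in `Polarization.lean`), the second is
  BIP Thm. 4.9(1) in weight form (`OrbitClosureWeights.lean`:
  `apply_eq_zero_of_hasHighestWeight_orbitCoordRep_of_vars_subset`) for the `n²` block variables.
* **Prop. 13**: "If `λ₁ < m`, then `a_λ(d[m]) = 0`" (§7: `a_λ(d[m]) ≤ K_{λ, d×m}` and "the
  pigeonhole principle says that for every placement of `m` 1s to the boxes of `λ` we will end up
  with at least one column containing the number 1 at least twice"). PROVED here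
  (`GIP2017_prop13`), by the same pigeonhole run on highest-weight vectors instead of Kostka
  numbers, in the word model of the tree (`PlethysmStability.lean`, BIP (4.1):
  `Sym^d Sym^n V = (⊗^{dn} V)^{S_d ≀ S_n}`, Prop. 3.3: the highest-weight vectors of weight `λ` of
  `⊗^{dn} V` are spanned by the polytabloids `e_T`, `T` standard of shape `λ`): if `λ` has fewer
  than `n` columns, two of the `n` positions of block `0` lie in one column of `T`, so BIP
  Lemma 4.3(1) (`StdFilling.blockSymmetrizer_polytabloid_eq_zero`) kills the wreath symmetrisation
  `Σ e_T` of EVERY polytabloid, hence there is no nonzero `S_d ≀ S_n`-invariant highest-weight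
  vector of weight `λ`, i.e. (dictionary `wordOfForm`) none of weight `λ^*` in `ℂ[Sym^n V^*]_d`.
  The printed statement tacitly has `d ≥ 1` (for `d = 0`, `λ = ∅` occurs: `a_∅(0[m]) = 1`); the
  theorem carries `0 < d`.
* **Prop. 14**: "Let `m ≥ 10`, `d ≥ 1`. Further let `λ ⊢ md`, `λ₁ ≥ 3`, `ℓ(λ) ≤ m²`. If
  `n ≥ m + 2`, then `sm(λ, n) > 0`", proved in §3 as the case `L = m²` of **Prop. 20**: "Let `λ` be
  partition of length at most `L` and `λ ∉ {(1²), (1³), (1⁴), (1⁷), (1⁸), (1¹²), (2,1²), (3,1²),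
  (2,1⁷)}` and also `λ ≠ (2,2,1^k)` for any `k`. Let `ℓ := max{⌈√L⌉ + 2, 12}`. Then
  `sm(λ, ℓ) > 0`." These two positivity statements are VENDORED as named facts (`GIP2017_prop14`,
  `GIP2017_prop20`, with the exceptional list `gipExceptionalShapes` and `ℓ(L) = gipEll L`), and
  Prop. 14 is PROVED from Prop. 20 exactly as on p. 12 (`GIP2017_prop14_of_prop20`: `λ₁ ≥ 3`
  excludes the one- and two-column exceptions, `|λ| = md ≥ 10` excludes `(3,1,1)`, and
  `ℓ(m²) = m + 2 ≤ n`). Prop. 20 itself rests on the semigroup property for `sm`/`am` (Prop. 15,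
  highest-weight vectors of `GL × GL` on `Sym^d(V ⊗ V^* ⊗ V)`), the symmetric/skew Kronecker
  coefficients of a column against a self-conjugate partition (Thm. 16, §6), explicit
  self-conjugate partitions (Prop. 17), a computer verification of `sm(λ, 7) > 0` for the small
  shapes (Prop. 18: "We use a program written by Harm Derksen and adjusted by Jesko Hüttenhain"),
  and Kronecker positivity for two-row partitions via the strict unimodality of `q`-binomial
  coefficients (Prop. 19, Prop. 37, Cor. 38 [Pak–Panova]) — not in the tree; this is the part of
  Thm. 10 that remains a named fact.

**Assembly** (`GIP2017_thm10_of_prop14`, `GIP2017_thm10_of_prop20`, PROVED): for `d ≥ 1`,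
Lemma 12 gives `a_λ(d[n]) > 0` and `ℓ(λ) ≤ n²`, Prop. 13 gives `λ₁ ≥ n ≥ 10 ≥ 3`, and Prop. 14
gives `sm(λ, m) > 0` for `m ≥ n + 2`; for `d = 0` (`λ = ∅`, not covered by Props. 13–14 as printed)
`sm(∅, m) = sk(∅, ∅) = 1` directly (`smPos_of_eq_zero`: `χ^∅(1) = dim S^∅ = f^∅ = 1`, so the
character sum `skCharSum ∅ ∅ = 2`). Hence the barrier fact `GCTMatrixPowering = GIP2017_thm10` holds
as soon as `GIP2017_prop20` (or `GIP2017_prop14`) is discharged: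
`GIP2017_thm10_holds := GIP2017_thm10_of_prop20 GIP2017_prop20_holds` is the remaining step.

## References

* [GesmundoIkenmeyerPanova2017] F. Gesmundo, C. Ikenmeyer, G. Panova, *Geometric complexity theory
  and matrix powering*, Diff. Geom. Appl. 55 (2017) 106–127 = arXiv:1611.00827 (held; flat
  numbering of the held text): Thm. 10 and its proof (p. 7: Lemma 12, Prop. 13, Prop. 14), §3
  (Props. 15, 17–20, Thm. 16; proof of Prop. 14 from Prop. 20, p. 12), §7 (proof of Prop. 13),
  §8 (Prop. 37, Cor. 38).
* [BurgisserIkenmeyerPanovaJAMS2019] P. Bürgisser, C. Ikenmeyer, G. Panova, J. AMS 32 (2019) =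
  arXiv:1604.06431v3: Prop. 3.3, (4.1), Lemma 4.3(1), Thm. 4.9(1) (the word model and the length
  bound used in the proofs of Prop. 13 and Lemma 12).
-/

noncomputable section

open scoped BigOperators

namespace Literature.Barriers.ValiantsHypothesis

open Literature.NumberTheory.DiophantineGeometry Literature.Computability.AlgebraicComplexity
  Literature.Computability.Complexity MvPolynomial

/-! ### 1. GIP Prop. 13 in the word model: shapes with fewer than `m` columns -/

section WordModel

variable {k : Type*} [Field k] [CharZero k] {N D m : ℕ} {Y : YoungDiagram}

/-- **Pigeonhole in one block (GIP §7, highest-weight form).** If the Young diagram `Y`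
(`|Y| = D m`, `D ≥ 1`) has fewer than `m` columns, then for EVERY standard filling `T` of `Y` the
wreath symmetrisation `Σ e_T` of the polytabloid vanishes: the `m` positions of block `0` occupy
cells in fewer than `m` columns, so two of them share a column, and BIP Lemma 4.3(1) applies ("for
every placement of `m` 1s to the boxes of `λ` we will end up with at least one column containing
the number 1 at least twice"). [cite: GesmundoIkenmeyerPanova2017, Prop. 13 (proof, §7)] -/
theorem blockSymmetrizer_polytabloid_eq_zero_of_rowLen_lt (hN : ∀ x ∈ Y.cells, x.1 < N)
    (hD : 0 < D) (hY : Y.rowLen 0 < m) (T : StdFilling (D * m) Y) :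
    blockSymmetrizer k D m (T.polytabloid k hN) = 0 := by
  classical
  set r₀ : Fin D := ⟨0, hD⟩ with hr₀
  have hcol : ∀ a ∈ (Finset.univ : Finset (Fin m)),
      (T.1 (finProdFinEquiv (r₀, a))).2 ∈ Finset.range (Y.rowLen 0) := by
    intro a _
    have hmem : ((T.1 (finProdFinEquiv (r₀, a))).1, (T.1 (finProdFinEquiv (r₀, a))).2) ∈ Y := by
      rw [Prod.mk.eta]; exact T.mem _
    rw [Finset.mem_range]
    exact lt_of_lt_of_le (YoungDiagram.mem_iff_lt_rowLen.mp hmem)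
      (Y.rowLen_anti 0 _ (Nat.zero_le _))
  have hcard : (Finset.range (Y.rowLen 0)).card < (Finset.univ : Finset (Fin m)).card := by
    simpa using hY
  obtain ⟨a, -, b, -, hab, habcol⟩ := Finset.exists_ne_map_eq_of_card_lt_of_maps_to hcard hcol
  refine T.blockSymmetrizer_polytabloid_eq_zero hN (p := finProdFinEquiv (r₀, a))
    (q := finProdFinEquiv (r₀, b)) ?_ habcol ?_
  · exact fun h => hab (Prod.ext_iff.mp (finProdFinEquiv.injective h)).2
  · rw [blockIdx_finProdFinEquiv, blockIdx_finProdFinEquiv]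

/-- **No wreath-invariant highest-weight vectors of weight `λ` when `λ₁ < m`** (word model of
`V^{⊗ Dm}`, `V = k^N`, `D ≥ 1`, characteristic zero): every `S_D ≀ S_m`-invariant highest-weight
vector `x` of weight `λ = ydWeight N Y` vanishes, since `|S_D ≀ S_m| · x = Σ x = ∑_T a_T Σ e_T = 0`
(BIP Prop. 3.3 in basis form, and the previous lemma). That is `HWV_λ(Sym^D Sym^m V) = 0`: the
plethysm coefficient `a_λ(D[m])` vanishes. [cite: GesmundoIkenmeyerPanova2017, Prop. 13] -/
theorem eq_zero_of_mem_highestWeightSpace_wordRep_of_rowLen_lt (hN : ∀ x ∈ Y.cells, x.1 < N)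
    (hd : Y.cells.card = D * m) (hD : 0 < D) (hY : Y.rowLen 0 < m) {x : Word N (D * m) → k}
    (hx : x ∈ highestWeightSpace (wordRep k N (D * m)) (ydWeight N Y))
    (hinv : ∀ τ ∈ blockPerms D m, wordPerm k τ x = x) : x = 0 := by
  classical
  obtain ⟨a, ha⟩ := exists_sum_smul_polytabloid_eq hN hd hx
  have hS : (blockPermsFinset D m).card • x =
      ∑ T, a T • blockSymmetrizer k D m (T.polytabloid k hN) := by
    rw [← blockSymmetrizer_apply_of_forall_wordPerm_eq k hinv, ← ha, map_sum]
    simp_rw [map_smul]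
  have h0 : (blockPermsFinset D m).card • x = 0 := by
    rw [hS]
    exact Finset.sum_eq_zero fun T _ => by
      rw [blockSymmetrizer_polytabloid_eq_zero_of_rowLen_lt hN hD hY T, smul_zero]
  rw [← Nat.cast_smul_eq_nsmul k] at h0
  exact (smul_eq_zero.mp h0).resolve_left (Nat.cast_ne_zero.mpr card_blockPermsFinset_pos.ne')

end WordModel

/-! ### 2. Back to `k[Sym^n (k^σ)]_d`, and GIP Prop. 13 on the matrix space -/

section Polynomials

variable {k : Type*} [Field k] [CharZero k] {σ : Type*} [LinearOrder σ] [Fintype σ] {M n d : ℕ}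

/-- **No highest-weight vectors of dual weight `λ^*` in `k[Sym^n (k^σ)]_d` when `λ₁ < n`**
(`d ≥ 1`; plethysm coefficient `a_λ(d[n]) = 0`). With `ρ : Fin M ≃ σ` order-reversing and
`λ ⊢ d·n` with at most `M` parts, every form `h` of degree `d` which is a highest-weight vector of
`coordRep` of weight `χ`, `-χ(ρ i) = λ_{i+1}`, is zero: its transported polarisation
`wordOfForm ρ n d h` is an `S_d ≀ S_n`-invariant highest-weight vector of weight `λ` of the word
model, hence zero, and the polarisation is injective (`eq_of_wordOfForm_eq`).
[cite: GesmundoIkenmeyerPanova2017, Prop. 13] -/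
theorem eq_zero_of_mem_highestWeightSpace_coordRep_of_sup_lt {ρ : Fin M ≃ σ} (hρ : StrictAnti ρ)
    (lam : Nat.Partition (d * n)) (hlam : lam.parts.card ≤ M) (hd : 0 < d)
    (hsup : lam.parts.sup < n) {h : MvPolynomial (DegIdx σ n) k} (hh : h.IsHomogeneous d)
    {χ : Weight σ} (hχ : ∀ i, -χ (ρ i) = Weight.ofPartition M lam i)
    (hhw : h ∈ highestWeightSpace (coordRep σ k n) χ) : h = 0 := by
  classical
  set Y := lam.youngDiagram with hY
  have hN : ∀ x ∈ Y.cells, x.1 < M := fun x hx => fst_lt_of_mem_youngDiagram lam hlam hx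
  have hdY : Y.cells.card = d * n := lam.card_cells_youngDiagram
  have hrow : Y.rowLen 0 < n := by
    rw [hY, rowLen_youngDiagram lam 0, ← sup_parts_eq_getD_sortedParts]
    exact hsup
  have hx : wordOfForm ρ n d h ∈ highestWeightSpace (wordRep k M (d * n)) (ydWeight M Y) := by
    have := wordOfForm_mem_highestWeightSpace hρ hh hhw
    rwa [show (fun i => -χ (ρ i)) = ydWeight M Y from by
      rw [hY, ydWeight_youngDiagram]
      funext i
      exact hχ i] at this
  have hinv : ∀ τ ∈ blockPerms d n, wordPerm k τ (wordOfForm ρ n d h) = wordOfForm ρ n d h :=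
    fun τ hτ => wordPerm_wordOfForm ρ h hτ
  have hx0 : wordOfForm ρ n d h = 0 :=
    eq_zero_of_mem_highestWeightSpace_wordRep_of_rowLen_lt hN hdY hd hrow hx hinv
  refine eq_of_wordOfForm_eq ρ hh (isHomogeneous_zero _ _ _) ?_
  rw [hx0]
  funext w
  rw [Pi.zero_apply, wordOfForm_apply, polarize, arrOf, coeff_zero, zero_div]

end Polynomials

/-- **GIP Prop. 13 (vanishing of plethysm coefficients), tree letters.** "If `λ₁ < m`, then
`a_λ(d[m]) = 0`" — contrapositive, on the matrix space `V = ℂ^{m²}` of the homogeneous setting and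
for `d ≥ 1` (tacit in print: `a_∅(0[m]) = 1`): if `λ ⊢ d·n` (at most `m²` parts, the side condition
of the truncating `Weight.dualOfPartition`) occurs in `ℂ[Sym^n V^*]`, i.e. the weight `λ^*` is a
highest weight of `coordRep (MatIdx m) ℂ n`, then `λ₁ ≥ n`. GIP prove it through
`a_λ(d[m]) ≤ K_{λ, d×m}` and the pigeonhole principle; here the pigeonhole is applied to the
highest-weight vectors directly (`eq_zero_of_mem_highestWeightSpace_coordRep_of_sup_lt`; a weight
pins the degree, `isHomogeneous_of_mem_highestWeightSpace`). [cite: GesmundoIkenmeyerPanova2017, Prop. 13] -/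
theorem GIP2017_prop13 {n m d : ℕ} (lam : Nat.Partition (d * n)) (hlam : lam.parts.card ≤ m * m)
    (hd : 0 < d) (h : HasHighestWeight (coordRep (MatIdx m) ℂ n) (partitionWeightLex m lam)) :
    n ≤ lam.parts.sup := by
  classical
  by_contra hlt
  rw [not_le] at hlt
  have hn : n ≠ 0 := by omega
  obtain ⟨v, hv0, hv⟩ := (hasHighestWeight_iff_exists _ _).mp h
  have hsize : (partitionWeightLex m lam).size = -((n * d : ℕ) : ℤ) := by
    rw [partitionWeightLex, Weight.size_toMatIdx, Weight.dualOfPartition, Weight.size_dual,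
      Weight.size_ofPartition_holds hlam, mul_comm]
  have hhom : v.IsHomogeneous d := isHomogeneous_of_mem_highestWeightSpace hn hv hsize
  exact hv0 (eq_zero_of_mem_highestWeightSpace_coordRep_of_sup_lt (strictAnti_revMatIdx m) lam
    hlam hd hlt hhom (neg_partitionWeightLex_revMatIdx m lam) hv)

/-! ### 3. GIP Lemma 12: the lift to `ℂ[𝔸]` and the length bound `ℓ(λ) ≤ n²` -/

/-- The unpadded block permanent `per_n` (top-left `n × n` block of the generic `m × m` matrix,
lexicographic variables) involves only the `n²` block variables. [cite: GesmundoIkenmeyerPanova2017, §2.2 (per_m ∈ 𝔸_n^m)] -/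
theorem vars_blockPerFormLex_subset (n m : ℕ) :
    ↑(Literature.Barriers.PneNP.blockPerFormLex n m).vars ⊆
      ((Finset.univ.image fun ij : TopBlockIdx n m × TopBlockIdx n m =>
        (toLex ((ij.1 : Fin m), (ij.2 : Fin m)) : MatIdx m)) : Set (MatIdx m)) := by
  classical
  intro x hx
  rw [Finset.mem_coe, Literature.Barriers.PneNP.blockPerFormLex,
    Literature.Barriers.PneNP.blockPerPoly, rename_rename] at hx
  obtain ⟨ij, -, rfl⟩ := Finset.mem_image.mp (vars_rename _ _ hx)
  rw [Finset.mem_coe, Finset.mem_image]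
  exact ⟨ij, Finset.mem_univ _, rfl⟩

/-- **GIP Lemma 12, tree letters.** "`q_λ(d[m]) ≤ a_λ(d[m])`. Moreover, if `q_λ(d[m]) > 0`, then
`ℓ(λ) ≤ m²` and `|λ| = md`": if `λ ⊢ d·n` occurs in `ℂ[\overline{GL_{m²} per_n}]` (`0 < n ≤ m`),
then `λ` occurs in `ℂ[𝔸] = ℂ[Sym^n V^*]` (the BLMW lift `hasHighestWeight_coordRep_of_orbitCoordRep`,
discharged in `Polarization.lean`: the orbit closure is a `GL`-stable affine subvariety of `𝔸`) and
`ℓ(λ) ≤ n²` ("just because the `per_m` has only `m²` variables": BIP Thm. 4.9(1) in weight form,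
`apply_eq_zero_of_hasHighestWeight_orbitCoordRep_of_vars_subset`, for the `n²` block variables).
`|λ| = d·n` is built into the typing. [cite: GesmundoIkenmeyerPanova2017, Lemma 12] -/
theorem GIP2017_lemma12 {n m d : ℕ} (hn : 0 < n) (hnm : n ≤ m) (lam : Nat.Partition (d * n))
    (hlam : lam.parts.card ≤ m * m)
    (h : HasHighestWeight (blockPerOrbitRep n m) (partitionWeightLex m lam)) :
    HasHighestWeight (coordRep (MatIdx m) ℂ n) (partitionWeightLex m lam) ∧
      lam.parts.card ≤ n ^ 2 := by
  classical
  change HasHighestWeight (orbitCoordRep (Literature.Barriers.PneNP.blockPerFormLex n m) n)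
    (partitionWeightLex m lam) at h
  refine ⟨hasHighestWeight_coordRep_of_orbitCoordRep_holds _ hn.ne'
    (Literature.Barriers.PneNP.blockPerFormLex_isHomogeneous hnm) h, ?_⟩
  apply card_parts_le_of_dualOfPartition_apply_eq_zero lam hlam
  intro i hi
  have hA := card_image_topBlockIdx_le n m hnm
  have h0 := apply_eq_zero_of_hasHighestWeight_orbitCoordRep_of_vars_subset (matIdxEquiv m) _ _
    (vars_blockPerFormLex_subset n m) h i (by omega)
  simpa only [partitionWeightLex, Weight.toMatIdx, OrderIso.symm_apply_apply] using h0

/-! ### 4. The case `d = 0`: `sm(∅, m) = sk(∅, ∅) = 1` -/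

/-- For the empty partition `∅ ⊢ 0` the character sum `skCharSum ∅ ∅` equals `2` (`= 2 · 0! · sk(∅, ∅)`
with `sk(∅, ∅) = 1`): `S_0` is trivial and `χ^∅(1) = dim S^∅ = f^∅ = 1`
(`finrank_spechtIdeal_holds`, `StdFilling.card_zero`). [cite: GesmundoIkenmeyerPanova2017, §2.1 (sk) and Thm. 8 (sm)] -/
theorem skCharSum_self_of_eq_zero {D : ℕ} (hD : D = 0) (lam : Nat.Partition D) :
    skCharSum lam lam = 2 := by
  subst hD
  have hfin : Module.finrank ℂ (spechtIdeal ℂ lam) = 1 := by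
    have h1 : Module.finrank ℂ (spechtIdeal ℂ lam) = numStandardTableaux lam :=
      finrank_spechtIdeal_holds (k := ℂ) lam
    rw [h1, numStandardTableaux_eq_card_stdFilling, StdFilling.card_zero]
  haveI : Module.Finite ℂ (spechtIdeal ℂ lam) := Module.finite_of_finrank_pos (by omega)
  have hχ : spechtCharacter ℂ lam 1 = 1 := by
    rw [spechtCharacter_eq_character, Representation.char_one, hfin, Nat.cast_one]
  have huniv : (Finset.univ : Finset (Equiv.Perm (Fin 0))) = {1} := by
    ext τ
    simp only [Finset.mem_univ, Finset.mem_singleton, true_iff]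
    exact Subsingleton.elim τ 1
  rw [skCharSum, huniv, Finset.sum_singleton, mul_one, hχ]
  norm_num

/-- `sm(∅, m) > 0` for the empty partition: the summand `μ = ∅` (no parts) has `sk(∅, ∅) = 1`.
This is the case `d = 0` of Thm. 10 (`q_∅(0[m]) = 1`), not covered by Props. 13–14 as printed.
[cite: GesmundoIkenmeyerPanova2017, Thm. 8 (definition of sm)] -/
theorem smPos_of_eq_zero {D : ℕ} (hD : D = 0) (m : ℕ) (lam : Nat.Partition D) : SmPos m lam := by
  refine ⟨lam, ?_, ?_⟩
  · rw [parts_eq_zero_of_eq_zero lam hD, Multiset.card_zero]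
    exact Nat.zero_le m
  · rw [SkPos, skCharSum_self_of_eq_zero hD]
    exact two_ne_zero

/-! ### 5. The positivity statements Prop. 14 and Prop. 20 (named facts), Prop. 14 from Prop. 20 -/

/-- Monotonicity of `sm(λ, ·) > 0` in the number of rows allowed: `sm(λ, a) = Σ_{ℓ(μ) ≤ a} sk(λ, μ)`
only gains summands (GIP §3, "`sm(λ, n) ≥ sm(λ, ℓ)`", p. 12). [cite: GesmundoIkenmeyerPanova2017, §3 (proof of Prop. 14)] -/
theorem SmPos.mono {D : ℕ} {lam : Nat.Partition D} {a b : ℕ} (hab : a ≤ b) (h : SmPos a lam) :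
    SmPos b lam := by
  obtain ⟨μ, hμ, hsk⟩ := h
  exact ⟨μ, hμ.trans hab, hsk⟩

/-- **GIP's exceptional list of Prop. 20**: the nine partitions
`{(1²), (1³), (1⁴), (1⁷), (1⁸), (1¹²), (2,1²), (3,1²), (2,1⁷)}`, as multisets of parts (the
additional family `(2,2,1^k)`, `k ≥ 0`, is excluded separately in `GIP2017_prop20`). The six columns
are those of length `a ∈ X_s = {2,3,4,7,8,12}`, "exactly the sets of exceptional column lengths,
for which `sm` ... is `0`" (Prop. 17). [cite: GesmundoIkenmeyerPanova2017, Prop. 20 (with Prop. 17, X_s)] -/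
def gipExceptionalShapes : Finset (Multiset ℕ) :=
  { Multiset.replicate 2 1, Multiset.replicate 3 1, Multiset.replicate 4 1, Multiset.replicate 7 1,
    Multiset.replicate 8 1, Multiset.replicate 12 1, {2, 1, 1}, {3, 1, 1},
    2 ::ₘ Multiset.replicate 7 1 }

/-- Membership in the exceptional list, spelled out. [cite: GesmundoIkenmeyerPanova2017, Prop. 20] -/
theorem mem_gipExceptionalShapes_iff (s : Multiset ℕ) :
    s ∈ gipExceptionalShapes ↔ s = Multiset.replicate 2 1 ∨ s = Multiset.replicate 3 1 ∨
      s = Multiset.replicate 4 1 ∨ s = Multiset.replicate 7 1 ∨ s = Multiset.replicate 8 1 ∨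
      s = Multiset.replicate 12 1 ∨ s = {2, 1, 1} ∨ s = {3, 1, 1} ∨
      s = 2 ::ₘ Multiset.replicate 7 1 := by
  simp only [gipExceptionalShapes, Finset.mem_insert, Finset.mem_singleton]

/-- Every exceptional shape has largest part `≤ 2` or has `5` boxes (arithmetic on the nine
members); so none of them has `λ₁ ≥ 3` and `|λ| ≥ 10`. [cite: GesmundoIkenmeyerPanova2017, §3 (proof of Prop. 14, p. 12)] -/
theorem sup_le_two_or_sum_eq_five_of_mem_gipExceptionalShapes {s : Multiset ℕ}
    (h : s ∈ gipExceptionalShapes) : s.sup ≤ 2 ∨ s.sum = 5 := by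
  rcases (mem_gipExceptionalShapes_iff s).mp h with
    rfl | rfl | rfl | rfl | rfl | rfl | rfl | rfl | rfl <;> decide

/-- GIP's row bound of Prop. 20, `ℓ(L) := max{⌈√L⌉ + 2, 12}`, written with the integer square root
`⌈√L⌉ = ⌊√(L-1)⌋ + 1` (valid for `L ≥ 1`; for `L = 0` both `max{⌈√0⌉ + 2, 12}` and the present
expression equal `12`). For `L = n²`, `n ≥ 10`, this is `n + 2` (`gipEll_sq`), as used on p. 12.
[cite: GesmundoIkenmeyerPanova2017, Prop. 20 (ℓ := max{⌈√L⌉+2, 12})] -/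
def gipEll (L : ℕ) : ℕ :=
  max (Nat.sqrt (L - 1) + 3) 12

/-- `ℓ(L) ≥ 12`. [cite: GesmundoIkenmeyerPanova2017, Prop. 20] -/
theorem twelve_le_gipEll (L : ℕ) : 12 ≤ gipEll L :=
  le_max_right _ _

/-- `ℓ(L) - 2 ≥ ⌈√L⌉`, i.e. `L ≤ (ℓ(L) - 2)²`: at most `L` rows fit the bound `(ℓ - 2)² ≥ L` of
Prop. 17 (`ℓ = ⌊√a⌋ + 2`). [cite: GesmundoIkenmeyerPanova2017, Prop. 20 (with Prop. 17)] -/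
theorem le_gipEll_sub_two_sq (L : ℕ) : L ≤ (gipEll L - 2) ^ 2 := by
  have h1 : L - 1 < (Nat.sqrt (L - 1) + 1) ^ 2 := Nat.lt_succ_sqrt' (L - 1)
  have h2 : Nat.sqrt (L - 1) + 1 ≤ gipEll L - 2 := by
    unfold gipEll
    omega
  have h3 := Nat.pow_le_pow_left h2 2
  omega

/-- Sharpness: whenever `ℓ(L) > 12` (so that `ℓ(L) = ⌈√L⌉ + 2`), `(ℓ(L) - 3)² < L ≤ (ℓ(L) - 2)²`,
i.e. `ℓ(L) - 2` is exactly the ceiling `⌈√L⌉` (with `le_gipEll_sub_two_sq`).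
[cite: GesmundoIkenmeyerPanova2017, Prop. 20 (ℓ := max{⌈√L⌉+2, 12})] -/
theorem gipEll_sub_three_sq_lt {L : ℕ} (h : 12 < gipEll L) : (gipEll L - 3) ^ 2 < L := by
  have hL : 1 ≤ L := by
    by_contra h0
    have hL0 : L = 0 := by omega
    rw [hL0] at h
    exact absurd h (by decide)
  have h1 : gipEll L - 3 = Nat.sqrt (L - 1) := by unfold gipEll at h ⊢; omega
  rw [h1]
  have h2 : Nat.sqrt (L - 1) ^ 2 ≤ L - 1 := Nat.sqrt_le' (L - 1)
  omega

/-- For `L = n²` with `n ≥ 10`: `ℓ(n²) = max{n + 2, 12} = n + 2` ("`ℓ = max{m+2, 12} = m+2 ≤ n`",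
p. 12). [cite: GesmundoIkenmeyerPanova2017, §3 (proof of Prop. 14, p. 12)] -/
theorem gipEll_sq {n : ℕ} (hn : 10 ≤ n) : gipEll (n ^ 2) = n + 2 := by
  have hs : Nat.sqrt (n ^ 2 - 1) = n - 1 := by
    symm
    rw [Nat.eq_sqrt']
    constructor
    · have : (n - 1) ^ 2 + 1 ≤ n ^ 2 := by nlinarith [Nat.sub_add_cancel (by omega : 1 ≤ n)]
      omega
    · rw [Nat.sub_add_cancel (by omega : 1 ≤ n)]
      exact Nat.sub_lt (by positivity) one_pos
  unfold gipEll
  rw [hs]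
  omega

/-- **GIP Prop. 20 (positivity of `sm` for almost all shapes), named fact.** "Let `λ` be partition
of length at most `L` and `λ ∉ {(1²), (1³), (1⁴), (1⁷), (1⁸), (1¹²), (2,1²), (3,1²), (2,1⁷)}` and
also `λ ≠ (2,2,1^k)` for any `k`. Let `ℓ := max{⌈√L⌉ + 2, 12}`. Then `sm(λ, ℓ) > 0`." Rendered with
`λ` a partition of any `D`, the exceptional list `gipExceptionalShapes`, the family `(2,2,1^k)`
(`k ≥ 0`) as `2 ::ₘ 2 ::ₘ replicate k 1`, `ℓ = gipEll L`, and `sm(λ, ℓ) > 0` as `SmPos ℓ λ` (the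
character form of `GCTMatrixPowering.lean`). The printed proof uses Prop. 15 (semigroup property
for `sm`, `am`), Thm. 16, Prop. 17 (columns), Prop. 18 (`sm(λ, 7) > 0` for every `λ` with
`ℓ(λ) ≤ 14` off a list of nine shapes, by a computer calculation for `λ₁ ≤ 3` and the semigroup
property beyond), Prop. 19 and Cor. 38 (Kronecker positivity for two-row partitions from the strict
unimodality of `q`-binomial coefficients [Pak–Panova]); none of these is in the tree.
[cite: GesmundoIkenmeyerPanova2017, Prop. 20] -/
def GIP2017_prop20 : Prop :=
  ∀ (D L : ℕ) (lam : Nat.Partition D), lam.parts.card ≤ L → lam.parts ∉ gipExceptionalShapes →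
    (∀ k : ℕ, lam.parts ≠ 2 ::ₘ 2 ::ₘ Multiset.replicate k 1) → SmPos (gipEll L) lam

/-- **GIP Prop. 14 (positivity), named fact, tree letters.** "Let `m ≥ 10`, `d ≥ 1`. Further let
`λ ⊢ md`, `λ₁ ≥ 3`, `ℓ(λ) ≤ m²`. If `n ≥ m + 2`, then `sm(λ, n) > 0`." With permanent size `n`
(GIP's `m`) and matrix size `m` (GIP's `n`): for `10 ≤ n`, `1 ≤ d`, `λ ⊢ d·n` with `λ₁ ≥ 3` and at
most `n²` parts, and `n + 2 ≤ m`, `SmPos m λ`. Proved from Prop. 20 below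
(`GIP2017_prop14_of_prop20`), as in print ("We prove a slightly more general result in Section 3
(Proposition 20, where `L = m²`)"). [cite: GesmundoIkenmeyerPanova2017, Prop. 14] -/
def GIP2017_prop14 : Prop :=
  ∀ (n m d : ℕ), 10 ≤ n → 1 ≤ d → ∀ lam : Nat.Partition (d * n), 3 ≤ lam.parts.sup →
    lam.parts.card ≤ n ^ 2 → n + 2 ≤ m → SmPos m lam

/-- **Prop. 14 from Prop. 20 (GIP p. 12, "Proof of Proposition 14").** "since `λ₁ ≥ 3`, we have that
`λ` is not a partition of 1 or 2 columns, and since `λ ⊢ dm ≥ 10`, we have that `λ` is not any of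
the exceptional partitions. We have that `ℓ(λ) ≤ m² = L`, and thus `ℓ = max{m+2, 12} = m+2 ≤ n`. So
`sm(λ, n) ≥ sm(λ, ℓ) > 0` by Proposition 20." [cite: GesmundoIkenmeyerPanova2017, Prop. 14 (proof from Prop. 20, §3)] -/
theorem GIP2017_prop14_of_prop20 (h20 : GIP2017_prop20) : GIP2017_prop14 := by
  intro n m d hn hd lam hsup hlen hnm
  have hsum : lam.parts.sum = d * n := lam.parts_sum
  have hdn : 10 ≤ d * n := le_trans hn (Nat.le_mul_of_pos_left n hd)
  have hexc : lam.parts ∉ gipExceptionalShapes := by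
    intro hmem
    rcases sup_le_two_or_sum_eq_five_of_mem_gipExceptionalShapes hmem with h2 | h5
    · omega
    · omega
  have h22 : ∀ k : ℕ, lam.parts ≠ 2 ::ₘ 2 ::ₘ Multiset.replicate k 1 := by
    intro k hk
    have hle : (2 ::ₘ 2 ::ₘ Multiset.replicate k 1).sup ≤ 2 := by
      rw [Multiset.sup_cons, Multiset.sup_cons]
      refine max_le le_rfl (max_le le_rfl (Multiset.sup_le.mpr fun b hb => ?_))
      rw [Multiset.eq_of_mem_replicate hb]
      exact one_le_two
    rw [← hk] at hle
    omega
  have h := h20 (d * n) (n ^ 2) lam hlen hexc h22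
  rw [gipEll_sq hn] at h
  exact h.mono hnm

/-! ### 6. Thm. 10 assembled -/

/-- **GIP Thm. 10 from Prop. 14** (the printed proof, p. 7): for `d ≥ 1`, an occurring `λ ⊢ d·n`
occurs in `ℂ[𝔸]` and has `ℓ(λ) ≤ n²` (Lemma 12, `GIP2017_lemma12`), hence `λ₁ ≥ n ≥ 10 ≥ 3`
(Prop. 13, `GIP2017_prop13`), and Prop. 14 gives `sm(λ, m) > 0` for `m ≥ n + 2`; for `d = 0`,
`λ = ∅` and `sm(∅, m) > 0` directly (`smPos_of_eq_zero`). [cite: GesmundoIkenmeyerPanova2017, Thm. 10 (proof, p. 7)] -/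
theorem GIP2017_thm10_of_prop14 (h14 : GIP2017_prop14) : GIP2017_thm10 := by
  intro n m d hn hnm lam hlam hocc
  rcases Nat.eq_zero_or_pos d with rfl | hd
  · exact smPos_of_eq_zero (Nat.zero_mul n) m lam
  · obtain ⟨hcoord, hlen⟩ := GIP2017_lemma12 (by omega) (by omega) lam hlam hocc
    have hsup : n ≤ lam.parts.sup := GIP2017_prop13 lam hlam hd hcoord
    exact h14 n m d hn hd lam (by omega) hlen hnm

/-- **GIP Thm. 10 from Prop. 20** (Prop. 14 being Prop. 20 with `L = m²`): the Main Result reduced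
to the single positivity statement `GIP2017_prop20`. [cite: GesmundoIkenmeyerPanova2017, Thm. 10 (proof, pp. 7 and 12)] -/
theorem GIP2017_thm10_of_prop20 (h20 : GIP2017_prop20) : GIP2017_thm10 :=
  GIP2017_thm10_of_prop14 (GIP2017_prop14_of_prop20 h20)

/-- The barrier fact `GCTMatrixPowering` (= Thm. 10) from Prop. 20. [cite: GesmundoIkenmeyerPanova2017, Thm. 10] -/
theorem gctMatrixPowering_of_prop20 (h20 : GIP2017_prop20) : GCTMatrixPowering :=
  GIP2017_thm10_of_prop20 h20

end Literature.Barriers.ValiantsHypothesis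

end
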